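import Literature.Geometry.Lorentzian.TeukolskyWronskianBound
import Literature.Geometry.Lorentzian.CarterConeArithmetic
import Literature.Geometry.Lorentzian.KerrSeparatedPotential
import HarnessLib

/-!
# Teixeira da Costa's Wronskian bound on the SUPERRADIANT OFF-CONE box of bounded frequencies:
# one constant for all sub-extremal spins (consequence of the named fact, `s = 0`)

(namespace `Literature.Geometry.Lorentzian.Kerr`.) The named fact
`Kerr.Costa2019_wronskianBound_subextremal` (R. Teixeira da Costa, CMP 378 (2020), Thm. 5.1, corrected
reading; `TeukolskyWronskianBound.lean`) bounds `|𝔚|⁻²` by `G(C)` for every `|a| < M` as soon as the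
frequency constant `|ω| + |ω|⁻¹ + max(|ω − m/2M|⁻¹, |ω + m/2M|⁻¹) + |m| + |λ|` is `≤ C`: the real
frequency must stay away from `0` AND from BOTH extremal thresholds `ω = ±m/(2M)` (the `sup` over
`a ∈ [−M, M]` of the printed `C_𝒜`). This file isolates the frequency bookkeeping by which the
near-extremal integrated-decay programme (crux `KappaExplicitWaveDecay`, DRSR §9.7 / Prop. 9.7.1 off the
superradiant threshold cone) consumes the fact:

* `Kerr.thresholds_of_superradiant_offCone` — for `0 < M`, `|a| ≤ M`, a SUPERRADIANT frequency
  (`ω(ω − mω₊) < 0`, i.e. `ω` strictly between `0` and `mω₊`) which is OFF the cone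
  (`ε₀|m| < |ω − mω₊|`): `m ≠ 0` and `min(ε₀, 1/(2M)) ≤ |ω ∓ m/(2M)|` for BOTH signs. (With
  `p = mω₊`, `|p| ≤ |m|/(2M) =: Q` since `|ω₊| ≤ 1/(2M)`: if `0 < ω < p` then `Q − ω ≥ p − ω > ε₀|m|`
  and `ω + Q > Q ≥ 1/(2M)`; symmetrically for `p < ω < 0`.) The NON-superradiant off-cone frequencies
  near `ω = −sgn(a)·m/(2M)` are NOT covered by the fact — and need not be: there the horizon flux has
  the favourable sign in the `T`-energy identity (DRSR §8.7.4), so no mode stability is required;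
* `Kerr.Costa2019_wronskianBound_subextremal.superradiant_offCone_box` — ONE constant `G > 0`,
  depending on `(M, ε₀, ω_l, ω_h, Λ_h)` only, with `1 ≤ G·|𝔚(r)|²` for EVERY `|a| < M`, every
  admissible superradiant off-cone triple with `ω_l ≤ |ω| ≤ ω_h`, `Λ ≤ Λ_h` (`λ = Λ − a²ω²`,
  `|m| ≤ √Λ_h`), every normalised pair `(R_𝓗, R_𝓘)` and every `r > r₊`.

Everything is proved (given the fact as a hypothesis); no new definition.

## References
* R. Teixeira da Costa, CMP 378 (2020) 705–781 = arXiv:1910.02854, Thm. 5.1. [Costa2019]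
* M. Dafermos, I. Rodnianski, Y. Shlapentokh-Rothman, arXiv:1402.7034, §8.7.4, §9.7, Prop. 9.7.1.
  [DafermosRodnianskiShlapentokhrothman2014]
-/

noncomputable section

open Set

namespace Literature.Geometry.Lorentzian.Kerr

/-! ### Superradiant off-cone frequencies avoid both extremal thresholds -/

/-- **Superradiant off-cone frequencies stay away from both extremal thresholds.** For `0 < M`,
`|a| ≤ M`, `0 < ε₀`, a superradiant frequency `ω(ω − mω₊) < 0` with `ε₀|m| < |ω − mω₊|` has `m ≠ 0`,
`min(ε₀, 1/(2M)) ≤ |ω − m/(2M)|` and `min(ε₀, 1/(2M)) ≤ |ω + m/(2M)|`.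
[cite: DafermosRodnianskiShlapentokhrothman2014, §9.7] -/
theorem thresholds_of_superradiant_offCone {M a ε₀ ω : ℝ} {m : ℤ} (hM : 0 < M) (haM : |a| ≤ M)
    (hε₀ : 0 < ε₀) (hsr : ω * (ω - m * horizonAngularVelocity M a) < 0)
    (hoff : ε₀ * |(m : ℝ)| < |ω - m * horizonAngularVelocity M a|) :
    m ≠ 0 ∧ min ε₀ (1 / (2 * M)) ≤ |ω - m / (2 * M)| ∧ min ε₀ (1 / (2 * M)) ≤ |ω + m / (2 * M)| := by
  set p : ℝ := m * horizonAngularVelocity M a with hp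
  have hm : m ≠ 0 := by
    rintro rfl
    have h0 : p = 0 := by simp [hp]
    rw [h0, sub_zero] at hsr
    exact absurd hsr (not_lt.2 (mul_self_nonneg ω))
  have hm1 : (1 : ℝ) ≤ |(m : ℝ)| := by exact_mod_cast Int.one_le_abs hm
  have hωplus : |horizonAngularVelocity M a| ≤ 1 / (2 * M) := abs_horizonAngularVelocity_le hM haM
  -- `|p| ≤ Q := |m|/(2M)` and `Q ≥ 1/(2M)`
  have hpQ : |p| ≤ |(m : ℝ)| / (2 * M) := by
    rw [hp, abs_mul]
    calc |(m : ℝ)| * |horizonAngularVelocity M a| ≤ |(m : ℝ)| * (1 / (2 * M)) :=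
          mul_le_mul_of_nonneg_left hωplus (abs_nonneg _)
      _ = |(m : ℝ)| / (2 * M) := by ring
  have hQ : 1 / (2 * M) ≤ |(m : ℝ)| / (2 * M) := by
    rw [div_le_div_iff_of_pos_right (by positivity)]
    exact hm1
  have hε : ε₀ ≤ ε₀ * |(m : ℝ)| := by nlinarith
  have hd₁ : min ε₀ (1 / (2 * M)) ≤ ε₀ := min_le_left _ _
  have hd₂ : min ε₀ (1 / (2 * M)) ≤ 1 / (2 * M) := min_le_right _ _
  -- the two signs of `m`: `m/(2M) = ±Q`
  have hmQ : (m : ℝ) / (2 * M) = |(m : ℝ)| / (2 * M) ∨ (m : ℝ) / (2 * M) = -(|(m : ℝ)| / (2 * M)) := by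
    rcases le_or_gt 0 (m : ℝ) with h | h
    · left; rw [abs_of_nonneg h]
    · right; rw [abs_of_neg h]; ring
  -- superradiance: `ω` strictly between `0` and `p`
  rcases mul_neg_iff.1 hsr with ⟨hω0, hωp⟩ | ⟨hω0, hωp⟩
  · -- `0 < ω < p`
    have hωp' : ω < p := by linarith
    have hp0 : 0 < p := hω0.trans hωp'
    have hpabs : p ≤ |(m : ℝ)| / (2 * M) := (le_abs_self p).trans hpQ
    have hgap : |ω - p| = p - ω := by rw [abs_sub_comm, abs_of_pos (by linarith)]
    rw [hgap] at hoff
    have hA : min ε₀ (1 / (2 * M)) ≤ |ω - |(m : ℝ)| / (2 * M)| := by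
      rw [abs_sub_comm, abs_of_pos (by linarith)]
      linarith
    have hB : min ε₀ (1 / (2 * M)) ≤ |ω + |(m : ℝ)| / (2 * M)| := by
      rw [abs_of_pos (by positivity)]
      linarith
    refine ⟨hm, ?_, ?_⟩
    · rcases hmQ with h | h
      · rwa [h]
      · rw [h, sub_neg_eq_add]; exact hB
    · rcases hmQ with h | h
      · rwa [h]
      · rw [h, ← sub_eq_add_neg]; exact hA
  · -- `p < ω < 0`
    have hωp' : p < ω := by linarith
    have hp0 : p < 0 := hωp'.trans hω0
    have hpabs : -(|(m : ℝ)| / (2 * M)) ≤ p := by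
      have := neg_abs_le p; linarith
    have hgap : |ω - p| = ω - p := abs_of_pos (by linarith)
    rw [hgap] at hoff
    have hA : min ε₀ (1 / (2 * M)) ≤ |ω + |(m : ℝ)| / (2 * M)| := by
      rw [abs_of_pos (by linarith)]
      linarith
    have hB : min ε₀ (1 / (2 * M)) ≤ |ω - |(m : ℝ)| / (2 * M)| := by
      rw [abs_of_neg (by linarith)]
      linarith
    refine ⟨hm, ?_, ?_⟩
    · rcases hmQ with h | h
      · rwa [h]
      · rw [h, sub_neg_eq_add]; exact hA
    · rcases hmQ with h | h
      · rwa [h]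
      · rw [h, ← sub_eq_add_neg]; exact hB

/-! ### The fact on the superradiant off-cone box -/

/-- **TdC Thm 5.1 on the superradiant off-cone box, one constant for all `|a| < M`** (`s = 0`).
Given the named fact `Costa2019_wronskianBound_subextremal`, for `0 < M`, `0 < ε₀`, `0 < ω_l` and any
`ω_h`, `Λ_h` there is `G > 0` such that for every `|a| < M`, every admissible triple `(ω, m, Λ)` which is
superradiant (`ω(ω − mω₊) < 0`), off the cone (`ε₀|m| < |ω − mω₊|`) and in the window
`ω_l ≤ |ω| ≤ ω_h`, `Λ ≤ Λ_h`, every pair of classical radial solutions `R_𝓗`, `R_𝓘` with `λ = Λ − a²ω²`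
normalised at `𝓗⁺` resp. `𝓘⁺`, and every `r > r₊`: `1 ≤ G·|𝔚(r)|²`. The frequency constant fed to the
fact is `ω_h + ω_l⁻¹ + (min(ε₀, 1/2M))⁻¹ + √Λ_h⁺ + (Λ_h⁺ + M²ω_h²)` (`Λ_h⁺ = max Λ_h 0`;
`|m| ≤ √Λ` for admissible triples; `thresholds_of_superradiant_offCone`), and `G` is the fact's
`G` there, maxed with `1`. [cite: Costa2019, Theorem 5.1] -/
theorem Costa2019_wronskianBound_subextremal.superradiant_offCone_box
    (h : Costa2019_wronskianBound_subextremal) {M ε₀ ωl : ℝ} (hM : 0 < M) (hε₀ : 0 < ε₀)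
    (hωl : 0 < ωl) (ωh Λh : ℝ) :
    ∃ G : ℝ, 0 < G ∧ ∀ a : ℝ, |a| < M →
      ∀ (ω : ℝ) (m : ℤ) (Λ : ℝ), IsAdmissibleTriple a ω m Λ →
        ω * (ω - m * horizonAngularVelocity M a) < 0 →
        ε₀ * |(m : ℝ)| < |ω - m * horizonAngularVelocity M a| →
        ωl ≤ |ω| → |ω| ≤ ωh → Λ ≤ Λh →
        ∀ RH RI : ℝ → ℂ,
          IsRadialTeukolskySolution M a 0 ω m (Λ - a ^ 2 * ω ^ 2) RH →
          IsNormalisedHorizonSolution M a 0 ω m RH →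
          IsRadialTeukolskySolution M a 0 ω m (Λ - a ^ 2 * ω ^ 2) RI →
          IsNormalisedInfinitySolution M 0 ω RI →
            ∀ r : ℝ, rPlus M a < r → 1 ≤ G * ‖radialWronskian M a 0 RH RI r‖ ^ 2 := by
  obtain ⟨Gf, hGf⟩ := h M 0 hM ⟨0, by norm_num⟩
  set d : ℝ := min ε₀ (1 / (2 * M)) with hd
  have hd0 : 0 < d := lt_min hε₀ (by positivity)
  set C : ℝ := ωh + ωl⁻¹ + d⁻¹ + Real.sqrt (max Λh 0) + (max Λh 0 + M ^ 2 * ωh ^ 2) with hC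
  refine ⟨max (Gf C) 1, lt_of_lt_of_le one_pos (le_max_right _ _), ?_⟩
  intro a ha ω m Λ hadm hsr hoff hωl' hωh hΛh RH RI hRH hnH hRI hnI r hr
  obtain ⟨hm, ht₁, ht₂⟩ := thresholds_of_superradiant_offCone hM ha.le hε₀ hsr hoff
  have hω0 : ω ≠ 0 := abs_pos.1 (hωl.trans_le hωl')
  have hne₁ : ω ≠ m / (2 * M) := fun e ↦ by
    rw [e, sub_self, abs_zero] at ht₁; exact absurd ht₁ (not_le.2 hd0)
  have hne₂ : ω ≠ -(m / (2 * M)) := fun e ↦ by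
    rw [e, neg_add_cancel, abs_zero] at ht₂; exact absurd ht₂ (not_le.2 hd0)
  -- the frequency constant
  have hΛ0 : 0 ≤ Λ := hadm.nonneg
  have hΛh' : Λ ≤ max Λh 0 := hΛh.trans (le_max_left _ _)
  have hmΛ : |(m : ℝ)| ≤ Real.sqrt (max Λh 0) := Real.abs_le_sqrt (hadm.sq_le.trans hΛh')
  have hinvω : |ω|⁻¹ ≤ ωl⁻¹ := (inv_le_inv₀ (hωl.trans_le hωl') hωl).2 hωl'
  have hmax : max |ω - m / (2 * M)|⁻¹ |ω + m / (2 * M)|⁻¹ ≤ d⁻¹ :=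
    max_le ((inv_le_inv₀ (hd0.trans_le ht₁) hd0).2 ht₁) ((inv_le_inv₀ (hd0.trans_le ht₂) hd0).2 ht₂)
  have hlam : |Λ - a ^ 2 * ω ^ 2| ≤ max Λh 0 + M ^ 2 * ωh ^ 2 := by
    have ha2 : a ^ 2 ≤ M ^ 2 := by
      rw [← sq_abs a]; exact pow_le_pow_left₀ (abs_nonneg a) ha.le 2
    have hω2 : ω ^ 2 ≤ ωh ^ 2 := by
      rw [← sq_abs ω]; exact pow_le_pow_left₀ (abs_nonneg ω) hωh 2
    have h1 : a ^ 2 * ω ^ 2 ≤ M ^ 2 * ωh ^ 2 :=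
      mul_le_mul ha2 hω2 (sq_nonneg ω) (sq_nonneg M)
    rw [abs_le]
    constructor <;> nlinarith [sq_nonneg a, sq_nonneg ω]
  have hCle : |ω| + |ω|⁻¹ + max |ω - (m : ℝ) / (2 * M)|⁻¹ |ω + (m : ℝ) / (2 * M)|⁻¹ + |(m : ℝ)| +
      |Λ - a ^ 2 * ω ^ 2| ≤ C := by
    simp only [hC]
    linarith
  obtain ⟨hG0, hb⟩ := hGf C a ω m (Λ - a ^ 2 * ω ^ 2) ha ⟨m, by simp⟩ hω0 hne₁ hne₂ hCle RH RI
    hRH hnH hRI hnI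
  calc (1 : ℝ) ≤ Gf C * ‖radialWronskian M a 0 RH RI r‖ ^ 2 := hb r hr
    _ ≤ max (Gf C) 1 * ‖radialWronskian M a 0 RH RI r‖ ^ 2 :=
        mul_le_mul_of_nonneg_right (le_max_left _ _) (sq_nonneg _)

end Literature.Geometry.Lorentzian.Kerr

end
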